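import Mathlib
import Literature.Barriers.NavierStokesRegularity.DyadicInvariantRegion
import Literature.Analysis.ODE.MaximalTime
import Summits.NavierStokesRegularity.NavierStokesRegularity.Theorems.SubOnsagerCeilingDyadicDampedTenRegionIneq
import HarnessLib

/-!
# The damped Barbato–Morandin–Romito region — variant with a QUIESCENT, FORCED datum shell,
# threshold `p ≥ 7/4`, slack `D̄ ≤ 1/10` (scale ratios `b ∈ [1.78, 2]`): the dynamical (first-exit) argument
(helper file for crux stmt-NavierStokesRegularity-27057 `SubOnsagerCeiling.ForwardTailCeilingKP`,
`--supports … --as helper`; LEAD SOC census v9 §G.1, tenure successor item (1) «RUNG 5 on b ∈ [1.78, 2], D̄ = 1/10»)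

`DyadicDamped.invariantRegion_le_one_of_tail_damped'` (LEAD g5, p649296's forced variant: threshold `p ≥ 47/25`,
slack `D̄ ≤ 1/5`) VERBATIM with the two constants changed to `p ≥ 7/4`, `D̄ ≤ 1/10` and the slack-sensitive face
inequalities taken from `SubOnsagerCeilingDyadicDampedTenRegionIneq` (LEAD g6; the `p`-free top face and bottom
corner from `SubOnsagerCeilingDyadicDampedRegionIneq`).

**Abstract statement** (`DyadicDampedTen.invariantRegion_le_one_of_tail_damped'`). Let `Y₀ ≡ 0` and let the
continuous non-negative functions `Y₁, Y₂, …` on `[0, s]` have right derivatives `Ẏₙ(t)` on `[0, s)` squeezed as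
`Gₙ(t) - D̄·Fₙ·Yₙ(t) ≤ Ẏₙ(t) ≤ Gₙ(t)` (`n ≥ 2`; at the datum shell `n = 1` only the lower squeeze),
`Gₙ = -κₙYₙ + Fₙ(Y²ₙ₋₁ - pYₙYₙ₊₁)`, with `0 < κₙ ≤ κₙ₊₁ ≤ 4κₙ`, `0 < Fₙ`, `Fₙ₊₁ = LFₙ`, `7/4 ≤ p`, `p² ≤ L`,
`pc = 1`, `D̄ ≤ 1/10`. If `Yₙ(0) ≤ 1/10` for all `n`, the datum shell is quiescent (`Y₁ ≤ 1/10` on `[0,s]`) and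
the tail is quiescent (`Yₙ ≤ 1/10` on `[0, s]` for `n ≥ K`), then `Yₙ(t) ≤ 1` for all `n` and `t ∈ [0, s]`.

HONEST FRAMING: an abstract ODE lemma towards a MODEL-lattice rung (crux `ForwardTailCeilingKP`, route
SubOnsagerCeiling, TL-M2Break) — the chain half of a joint region «chain + slaved side drain»; by itself it
proves no class of tables; nothing here bears on Navier–Stokes regularity.
[cite: BarbatoMorandinRomito2011, §2 Lemma 2.1 and its proof]
-/

noncomputable section

-- the sub-problem namespace `NavierStokesRegularity.NavierStokesRegularity` is the tree's layout (D-0017)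
set_option linter.dupNamespace false

namespace Summit.NavierStokesRegularity.NavierStokesRegularity.Theorems.DyadicDampedTen

open Set Filter Topology
open Literature.Barriers.NavierStokesRegularity.Dyadic

/-- **BMR region on an infinite chain with a quiescent tail AND a quiescent forced datum shell, damped
dynamics** (see the module docstring).
[cite: BarbatoMorandinRomito2011, §2 Lemma 2.1] -/
theorem invariantRegion_le_one_of_tail_damped' {Y Y' : ℕ → ℝ → ℝ} {κ F : ℕ → ℝ} {L p c s Db : ℝ}
    {K : ℕ} (hs : 0 < s)
    (hκ : ∀ n, 0 < κ n) (hκmono : ∀ n, κ n ≤ κ (n + 1)) (hκ4 : ∀ n, κ (n + 1) ≤ 4 * κ n)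
    (hF : ∀ n, 0 < F n) (hFL : ∀ n, F (n + 1) = L * F n)
    (hp : 7 / 4 ≤ p) (hpL : p ^ 2 ≤ L) (hpc : p * c = 1) (hDb : Db ≤ 1 / 10)
    (hY0 : ∀ t, Y 0 t = 0)
    (hcont : ∀ n, ContinuousOn (Y n) (Icc 0 s))
    (hderiv : ∀ n, 1 ≤ n → ∀ t ∈ Ico 0 s, HasDerivWithinAt (Y n) (Y' n t) (Ici t) t)
    (hup : ∀ n, 2 ≤ n → ∀ t ∈ Ico 0 s,
      Y' n t ≤ -κ n * Y n t + F n * (Y (n - 1) t ^ 2 - p * Y n t * Y (n + 1) t))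
    (hY1 : ∀ t ∈ Icc 0 s, Y 1 t ≤ 1 / 10)
    (hlo : ∀ n, 1 ≤ n → ∀ t ∈ Ico 0 s,
      -κ n * Y n t + F n * (Y (n - 1) t ^ 2 - p * Y n t * Y (n + 1) t) - Db * F n * Y n t ≤ Y' n t)
    (hpos : ∀ n, ∀ t ∈ Icc 0 s, 0 ≤ Y n t)
    (hinit : ∀ n, Y n 0 ≤ 1 / 10)
    (htail : ∀ n, K ≤ n → ∀ t ∈ Icc 0 s, Y n t ≤ 1 / 10) :
    ∀ n, ∀ t ∈ Icc 0 s, Y n t ≤ 1 := by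
  have hp0 : 0 < p := by linarith
  have hL0 : 0 < L := lt_of_lt_of_le (by positivity) hpL
  have hc0 : 0 < c := by
    have : 0 < p * c := by rw [hpc]; exact one_pos
    exact pos_of_mul_pos_right this hp0.le
  -- the lower curve
  set h : ℝ → ℝ := fun x => if x ≤ 1 / 10 then (0 : ℝ) else c * ((x - 1 / 10) / (9 / 10)) ^ 4
    with hh
  -- the constraint predicate (only the first `K` pairs can be active)
  set P : ℝ → Prop := fun t =>
    (∀ n ∈ Finset.Icc 1 K, Y n t ≤ 1) ∧
      (∀ n ∈ Finset.Icc 1 K, Y (n + 1) t ≤ 1 / 2 * Y n t + 3 / 5) ∧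
      (∀ n ∈ Finset.Icc 1 K, h (Y n t) ≤ Y (n + 1) t) with hP
  suffices key : ∀ t ∈ Icc 0 s, P t by
    intro n t ht
    rcases Nat.eq_zero_or_pos n with rfl | hn1
    · rw [hY0]; norm_num
    rcases le_or_gt K n with hKn | hnK
    · linarith [htail n hKn t ht]
    · have := key t ht
      simp only [hP] at this
      exact this.1 n (Finset.mem_Icc.2 ⟨hn1, hnK.le⟩)
  -- `P 0`
  have hP0 : P 0 := by
    simp only [hP]
    refine ⟨fun n _ => ?_, fun n _ => ?_, fun n _ => ?_⟩
    · linarith [hinit n]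
    · have h1 := hinit (n + 1)
      have h2 := hpos n 0 ⟨le_rfl, hs.le⟩
      linarith
    · have h1 := hinit n
      rw [hh]; dsimp only; rw [if_pos h1]
      exact hpos (n + 1) 0 ⟨le_rfl, hs.le⟩
  -- the constraints are closed
  have hclosed : ∀ t ∈ Ioc 0 s, (∀ r ∈ Ico 0 t, P r) → P t := by
    intro t ht hPs
    simp only [hP] at hPs ⊢
    refine ⟨fun n hn => ?_, fun n hn => ?_, fun n hn => ?_⟩
    · exact le_of_forall_Ico_le (hcont n) continuousOn_const ht fun r hr => (hPs r hr).1 n hn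
    · exact le_of_forall_Ico_le (hcont (n + 1))
        ((continuousOn_const.mul (hcont n)).add continuousOn_const) ht
        fun r hr => (hPs r hr).2.1 n hn
    · exact le_of_forall_Ico_le ((continuous_lowerCurve c).comp_continuousOn (hcont n))
        (hcont (n + 1)) ht fun r hr => (hPs r hr).2.2 n hn
  -- the maximal time
  set T := Literature.Analysis.ODE.maximalTimeP P 0 s with hT
  have hTmem : T ∈ Icc 0 s := Literature.Analysis.ODE.maximalTimeP_mem hs.le hP0
  have hPT : ∀ t ∈ Icc 0 T, P t := fun t ht =>
    Literature.Analysis.ODE.maximalTimeP_spec hs.le hP0 hclosed ht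
  by_contra hall
  have hTb : T < s := by
    rcases lt_or_eq_of_le hTmem.2 with hlt | heq
    · exact hlt
    · exact absurd (fun t ht => hPT t (heq ▸ ht)) hall
  have hT0 : 0 ≤ T := hTmem.1
  have hTs : T ∈ Icc 0 s := ⟨hT0, hTb.le⟩
  have hTs' : T ∈ Ico 0 s := ⟨hT0, hTb⟩
  -- the state at time `T`
  have hPτ := hPT T ⟨hT0, le_rfl⟩
  simp only [hP] at hPτ
  obtain ⟨hR, hTop, hBot⟩ := hPτ
  have hposT : ∀ k, 0 ≤ Y k T := fun k => hpos k T hTs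
  have htailT : ∀ k, K ≤ k → Y k T ≤ 1 / 10 := fun k hk => htail k hk T hTs
  have hle1 : ∀ k, Y k T ≤ 1 := by
    intro k
    rcases Nat.eq_zero_or_pos k with rfl | hk1
    · rw [hY0]; norm_num
    rcases le_or_gt K k with hKk | hkK
    · linarith [htailT k hKk]
    · exact hR k (Finset.mem_Icc.2 ⟨hk1, hkK.le⟩)
  -- the upper neighbour is at least `h` of the mode
  have hlow : ∀ k, 1 ≤ k → 1 / 10 ≤ Y k T →
      c * ((Y k T - 1 / 10) / (9 / 10)) ^ 4 ≤ Y (k + 1) T := by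
    intro k hk1 hkδ
    rcases le_or_gt k K with hkK | hKk
    · have := hBot k (Finset.mem_Icc.2 ⟨hk1, hkK⟩)
      rw [hh] at this; dsimp only at this
      rcases eq_or_lt_of_le hkδ with heq | hgt
      · rw [← heq]; norm_num; exact hposT (k + 1)
      · rwa [if_neg (not_le.2 hgt)] at this
    · have heq : Y k T = 1 / 10 := le_antisymm (htailT k hKk.le) hkδ
      rw [heq]; norm_num; exact hposT (k + 1)
  -- the upper neighbour is at most `Y/2 + 3/5`
  have hupp : ∀ k, 1 ≤ k → Y (k + 1) T ≤ 1 / 2 * Y k T + 3 / 5 := by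
    intro k hk1
    rcases le_or_gt k K with hkK | hKk
    · exact hTop k (Finset.mem_Icc.2 ⟨hk1, hkK⟩)
    · have h1 := htailT (k + 1) (by omega)
      have h2 := hposT k
      linarith
  -- continuity within `[T, ∞)` at `T` (from continuity on `[0, s]`, `T < s`)
  have hnhds : Icc 0 s ∈ 𝓝[Ici T] T := Icc_mem_nhdsGE_of_mem ⟨hT0, hTb⟩
  have hcw : ∀ k, ContinuousWithinAt (Y k) (Ici T) T := fun k =>
    ((hcont k) T hTs).mono_of_mem_nhdsWithin hnhds
  -- derivatives at `T` and their two-sided bounds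
  have hd : ∀ k, 1 ≤ k → HasDerivWithinAt (Y k) (Y' k T) (Ici T) T :=
    fun k hk1 => hderiv k hk1 T hTs'
  have hupT : ∀ k, 2 ≤ k →
      Y' k T ≤ -κ k * Y k T + F k * (Y (k - 1) T ^ 2 - p * Y k T * Y (k + 1) T) :=
    fun k hk1 => hup k hk1 T hTs'
  have hY1T : Y 1 T ≤ 1 / 10 := hY1 T hTs
  have hloT : ∀ k, 1 ≤ k →
      -κ k * Y k T + F k * (Y (k - 1) T ^ 2 - p * Y k T * Y (k + 1) T) - Db * F k * Y k T ≤ Y' k T :=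
    fun k hk1 => hlo k hk1 T hTs'
  ------------------------------------------------------------------
  -- (R) the constraints `Yₙ ≤ 1` persist
  ------------------------------------------------------------------
  have evR : ∀ n ∈ Finset.Icc 1 K, ∀ᶠ t in 𝓝[Ici T] T, Y n t ≤ 1 := by
    intro n hn
    obtain ⟨hn1, hnK⟩ := Finset.mem_Icc.1 hn
    rcases lt_or_eq_of_le (hle1 n) with hlt | heq
    · exact ((hcw n).eventually_lt_const hlt).mono fun t ht => ht.le
    · have hφ := (hd n hn1).sub_const 1
      have hz : c ≤ Y (n + 1) T := by
        have := hlow n hn1 (by rw [heq]; norm_num)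
        rw [heq] at this
        norm_num at this
        exact this
      have hn2 : 2 ≤ n := by
        by_contra hlt
        have h1 : n = 1 := by omega
        rw [h1] at heq
        linarith
      have hneg : Y' n T < 0 := by
        have hu := hupT n hn2
        rw [heq] at hu
        exact DyadicDamped.rhs_le_at_one_damped (hκ n) (hF n).le hp0.le hpc (hposT (n - 1)) (hle1 (n - 1)) hz hu
      exact (eventually_nonpos_of_hasDerivWithinAt_neg hφ hneg (by simp [heq])).mono
        fun t ht => by linarith
  ------------------------------------------------------------------
  -- (T) the constraints `Y_{n+1} ≤ Yₙ/2 + 3/5` persist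
  ------------------------------------------------------------------
  have evT : ∀ n ∈ Finset.Icc 1 K, ∀ᶠ t in 𝓝[Ici T] T,
      Y (n + 1) t ≤ 1 / 2 * Y n t + 3 / 5 := by
    intro n hn
    obtain ⟨hn1, hnK⟩ := Finset.mem_Icc.1 hn
    rcases lt_or_eq_of_le (hupp n hn1) with hlt | heq
    · have hc2 : ContinuousWithinAt (fun t => Y (n + 1) t - (1 / 2 * Y n t + 3 / 5)) (Ici T) T :=
        (hcw (n + 1)).sub ((continuousWithinAt_const.mul (hcw n)).add continuousWithinAt_const)
      have hlt' : Y (n + 1) T - (1 / 2 * Y n T + 3 / 5) < 0 := by linarith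
      exact (hc2.eventually_lt_const hlt').mono
        fun t (ht : Y (n + 1) t - (1 / 2 * Y n t + 3 / 5) < 0) => by linarith
    · -- active constraint: the derivative is strictly negative (damped piece `n₂`)
      have hdn := hd n hn1
      have hdn1 := hd (n + 1) (by omega)
      have hφ := hdn1.sub ((hdn.const_mul (1 / 2 : ℝ)).add_const (3 / 5 : ℝ))
      have hy1 : Y (n + 1) T ≤ 1 := hle1 (n + 1)
      have hyδ : 1 / 10 ≤ Y (n + 1) T := by rw [heq]; linarith [hposT n]
      have hz := hlow (n + 1) (by omega) hyδ
      have hu1 := hupT (n + 1) (by omega)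
      simp only [Nat.add_sub_cancel] at hu1
      rw [hFL n] at hu1
      have hl0 := hloT n hn1
      have hneg : Y' (n + 1) T - 1 / 2 * Y' n T < 0 :=
        top_slant_deriv_neg_damped (hκ n) (hκmono n) (hF n) hp hpL hpc (hposT n) heq hy1 hz hDb
          hu1 hl0
      have h0 : Y (n + 1) T - (1 / 2 * Y n T + 3 / 5) ≤ 0 := by linarith
      exact (eventually_nonpos_of_hasDerivWithinAt_neg hφ (by linarith [hneg]) h0).mono
        fun t (ht : Y (n + 1) t - (1 / 2 * Y n t + 3 / 5) ≤ 0) => by linarith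
  ------------------------------------------------------------------
  -- (B) the constraints `h(Yₙ) ≤ Y_{n+1}` persist
  ------------------------------------------------------------------
  have evB : ∀ n ∈ Finset.Icc 1 K, ∀ᶠ t in 𝓝[Ici T] T, h (Y n t) ≤ Y (n + 1) t := by
    intro n hn
    obtain ⟨hn1, hnK⟩ := Finset.mem_Icc.1 hn
    by_cases hxδ : Y n T < 1 / 10
    · -- flat bottom piece: `h ≡ 0` and positivity
      have ev1 : ∀ᶠ t in 𝓝[Ici T] T, Y n t < 1 / 10 := (hcw n).eventually_lt_const hxδ
      have ev2 : ∀ᶠ t in 𝓝[Ici T] T, t ∈ Icc 0 s := by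
        filter_upwards [hnhds] with t ht using ht
      filter_upwards [ev1, ev2] with t ht hts
      rw [hh]; dsimp only; rw [if_pos ht.le]
      exact hpos (n + 1) t hts
    · push Not at hxδ
      rcases lt_or_eq_of_le (show h (Y n T) ≤ Y (n + 1) T from
          hBot n (Finset.mem_Icc.2 ⟨hn1, hnK⟩)) with hlt | heq
      · have hc2 : ContinuousWithinAt (fun t => h (Y n t) - Y (n + 1) t) (Ici T) T :=
          (((continuous_lowerCurve c).continuousAt).comp_continuousWithinAt (hcw n)).sub (hcw (n + 1))
        have hlt' : h (Y n T) - Y (n + 1) T < 0 := by linarith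
        exact (hc2.eventually_lt_const hlt').mono fun t ht => by linarith
      · -- active constraint on the curved bottom piece
        have hdn := hd n hn1
        have hdn1 := hd (n + 1) (by omega)
        have hchain := (hasDerivAt_lowerCurve c (Y n T)).comp_hasDerivWithinAt T hdn
        have hφ := hchain.sub hdn1
        have h0 : h (Y n T) - Y (n + 1) T ≤ 0 := by rw [heq]; simp
        have hl1 := hloT (n + 1) (by omega)
        simp only [Nat.add_sub_cancel] at hl1
        rw [hFL n] at hl1
        rcases eq_or_lt_of_le hxδ with hxeq | hxgt
        · -- the corner `x = δ`: `h = h' = 0`, `Y_{n+1} = 0`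
          have hy0 : Y (n + 1) T = 0 := by
            rw [← heq, hh]; dsimp only; rw [if_pos hxeq.symm.le]
          rw [hy0, ← hxeq] at hl1
          have hneg : (if Y n T ≤ 1 / 10 then (0 : ℝ)
                else 4 * c * ((Y n T - 1 / 10) / (9 / 10)) ^ 3 / (9 / 10)) * Y' n T - Y' (n + 1) T < 0 := by
            rw [if_pos hxeq.symm.le]
            exact DyadicDamped.bottom_corner_deriv_neg_damped (hF n) hL0 hl1
          exact (eventually_nonpos_of_hasDerivWithinAt_neg hφ hneg h0).mono fun t ht => by
            simpa [Function.comp, hh] using ht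
        · -- `x > δ`: damped piece `n₅`
          have hy : Y (n + 1) T = c * ((Y n T - 1 / 10) / (9 / 10)) ^ 4 := by
            rw [← heq, hh]; dsimp only; rw [if_neg (not_le.2 hxgt)]
          have hx1 : Y n T ≤ 1 := hle1 n
          have hzupp := hupp (n + 1) (by omega)
          have hn2 : 2 ≤ n := by
            by_contra hlt
            have h1 : n = 1 := by omega
            rw [h1] at hxgt
            linarith
          have hu0 := hupT n hn2
          have hneg : (if Y n T ≤ 1 / 10 then (0 : ℝ)
                else 4 * c * ((Y n T - 1 / 10) / (9 / 10)) ^ 3 / (9 / 10)) * Y' n T - Y' (n + 1) T < 0 := by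
            rw [if_neg (not_le.2 hxgt)]
            exact bottom_curve_deriv_neg_damped (hκ n).le (hκ4 n) (hF n) hp hpL hpc hxgt.le hx1
              hy hzupp (hposT (n - 1)) (hle1 (n - 1)) hDb hu0 hl1
          exact (eventually_nonpos_of_hasDerivWithinAt_neg hφ hneg h0).mono fun t ht => by
            simpa [Function.comp, hh] using ht
  ------------------------------------------------------------------
  -- exit: `P` holds eventually at `T` within `[0, s]`, contradicting `T < s`
  ------------------------------------------------------------------
  have hright : ∀ᶠ t in 𝓝[Ici T] T, P t := by
    have e1 := (Filter.eventually_all_finset _).2 evR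
    have e2 := (Filter.eventually_all_finset _).2 evT
    have e3 := (Filter.eventually_all_finset _).2 evB
    filter_upwards [e1, e2, e3] with t h1 h2 h3
    simp only [hP]
    exact ⟨h1, h2, h3⟩
  exact Literature.Analysis.ODE.not_eventually_of_maximalTimeP_lt hs.le hP0 hTb
    (eventually_nhdsWithin_Icc_of_left_of_right hPT hright)

end Summit.NavierStokesRegularity.NavierStokesRegularity.Theorems.DyadicDampedTen

end
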